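import Summits.CriticalPhenomena.SAWScalingLimit.Theorems.SAWLoopFugacityFlowAvoidanceLimitAnchorDefs
import Summits.CriticalPhenomena.SAWScalingLimit.Theorems.SAWLoopFugacityFlowAvoidanceLimitSawEndpoint
import Summits.CriticalPhenomena.SAWScalingLimit.Theorems.SAWLoopFugacityFlowAvoidanceLimitCritLineMonotone
import Literature.Probability.LatticeModels.DiluteLoopModelAnalyticity

/-!
# Walk/loop factorisation of the strictly dilute two-source partition function —
helper `partitionFunction_sources_eq_sum_paths` of the lever `stub_cornerLipschitz` of line
`saw-corner-germ` (crux `SAWLoopFugacityFlow.AvoidanceLimit`, stmt-CriticalPhenomena-10649)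

For the strictly dilute loop-dressed SAW (tree `DiluteLoopModel ⟨n, 0, x⟩`, collision weight `w = 0`) on
a subgraph `H ≤ ℤ²`, volume `Λ` and two distinct sources `a ≠ b`:

  `Z_{n,0,x}(Λ; {a} ∆ {b}) = Σ_{γ ∈ pathsIn H Λ a b} x^{|γ|} · Z_{n,0,x}(Λ ∖ γ; ∅)`.

At collision weight `0` only collision-free configurations survive (`partitionFunction_dilute_eq_sum`
of `…CritLineMonotone.lean`); a collision-free configuration `F` with sources `{a, b}` is its open
strand `γ(F)` — the UNIQUE self-avoiding path from `a` to `b` with edges in `F`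
(`DetExpansion.exists_path_of_mem_cfConfigs`, uniqueness `path_eq_of_edges_subset` below: degree `1`
at `a`, `≤ 2` elsewhere) — together with the source-free collision-free configuration `F ∖ γ` on
the vertices OFF `γ`, and conversely gluing any `γ ∈ pathsIn H Λ a b` to any source-free
collision-free configuration of `Λ ∖ γ` gives such an `F` (`union_path_mem_cfConfigs`); the weights
multiply, `x^{|F|} = x^{|γ|} x^{|F ∖ γ|}`, `loops_Λ F = loops_{Λ∖γ} (F ∖ γ)`
(`card_eq_length_add_card_sdiff`, `loops_eq_loops_sdiff_path`, `DetExpansion.loops_congr_vol`; the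
bijection is `sum_cfConfigs_sources_eq_sum_sigma`). The `n = 0` case is the tree's
`DiluteLoopModel.partitionFunction_zero_zero_eq_sum_paths`; the inequality `≤ (Σ_γ x^{|γ|}) Z(Λ; ∅)`
for `n ≥ 0` is `partitionFunction_two_le`.

Sources: N. Madras, G. Slade, *The Self-Avoiding Walk* (1993), §1.2 [MadrasSlade1993]; W. Guo,
H. Blöte, B. Nienhuis, Int. J. Mod. Phys. C 10 (1999) 301, §1 eq. (1), §2 [GuoBloteNienhuis1999].
No definitions; no statement of the line is asserted here.
-/

noncomputable section

open Finset Filter Topology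
open scoped symmDiff
open Literature.Probability.RandomPlanarGeometry Literature.Probability.LatticeModels
open Summit.CriticalPhenomena.SAWScalingLimit.Theorems.AvoidanceLimit.Anchor

namespace Summit.CriticalPhenomena.SAWScalingLimit.Theorems.AvoidanceLimit.Corner

section Factorisation

open DiluteLoopModel SimpleGraph DetExpansion

variable {H : SimpleGraph (Site 2)}

/-- **The open strand is unique**: two self-avoiding paths from `a` to `b` whose edges lie in an
edge set `F` of degree `≤ 1` at `a` and `≤ 2` everywhere coincide (follow the unique edge at `a`,
erase it, recurse). [folklore] -/
theorem path_eq_of_edges_subset {a b : Site 2} {F : Finset (Sym2 (Site 2))} {p q : H.Walk a b}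
    (hp : p.IsPath) (hq : q.IsPath) (hpF : p.edges.toFinset ⊆ F) (hqF : q.edges.toFinset ⊆ F)
    (ha : #(F.filter fun e => a ∈ e) ≤ 1) (hdeg : ∀ z, #(F.filter fun e => z ∈ e) ≤ 2) : p = q := by
  induction p generalizing F with
  | nil => exact ((Walk.isPath_iff_nil.1 hq).eq_nil).symm
  | @cons a v b hav p' ih =>
    rw [Walk.cons_isPath_iff] at hp
    cases q with
    | nil => exact absurd p'.end_mem_support hp.2
    | @cons _ w _ haw q' =>
      rw [Walk.cons_isPath_iff] at hq
      have hev : s(a, v) ∈ F := hpF (by simp)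
      have hew : s(a, w) ∈ F := hqF (by simp)
      -- the first edges agree: both are the unique edge of `F` at `a`
      obtain rfl : v = w := by
        have := eq_of_deg_le_one ha hev (Sym2.mem_mk_left _ _) hew (Sym2.mem_mk_left _ _)
        rcases Sym2.eq_iff.1 this with ⟨-, h⟩ | ⟨-, h⟩
        · exact h
        · exact absurd h.symm hav.ne
      have hsub : ∀ {r : H.Walk v b}, r.IsPath ∧ a ∉ r.support →
          (Walk.cons hav r).edges.toFinset ⊆ F → r.edges.toFinset ⊆ F.erase s(a, v) := by
        rintro r hr hrF e he
        refine mem_erase.2 ⟨?_, hrF ?_⟩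
        · rintro rfl
          exact hr.2 (r.fst_mem_support_of_mem_edges (List.mem_toFinset.1 he))
        · rw [Walk.edges_cons, List.toFinset_cons]
          exact mem_insert_of_mem he
      have hdv : #((F.erase s(a, v)).filter fun e => v ∈ e) ≤ 1 := by
        have h := deg_erase hev v
        rw [if_pos (Sym2.mem_mk_right _ _)] at h
        have := hdeg v
        omega
      rw [ih hp.1 hq.1 (hsub hp hpF) (hsub hq hqF) hdv
        fun z => (deg_mono (erase_subset _ F) z).trans (hdeg z)]

/-- **The closed strands live off the open strand**: for the open strand `γ ⊆ F` avoided by the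
other edges, `loops_Λ F = loops_{Λ ∖ γ} (F ∖ γ)` (`loops_eq_loops_sdiff_path` and locality of
`loops` in the volume). [folklore] -/
theorem loops_eq_loops_sdiff_path_sdiff (hH : H ≤ zdGraph 2) {Λ : Finset (Site 2)} {a b : Site 2}
    {F : Finset (Sym2 (Site 2))} {p : H.Walk a b} (hp : p.IsPath) (ha : a ∈ Λ)
    (hpE : p.edges.toFinset ⊆ F)
    (havoid : ∀ e ∈ F, e ∉ p.edges.toFinset → ∀ z ∈ p.support, z ∉ e) :
    loops Λ F ∅ = loops (Λ \ p.support.toFinset) (F \ p.edges.toFinset) ∅ := by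
  rw [loops_eq_loops_sdiff_path hH hp ha hpE havoid]
  refine loops_congr_vol fun y hy =>
    ⟨fun h => mem_sdiff.2 ⟨h, fun hP => ?_⟩, fun h => (mem_sdiff.1 h).1⟩
  obtain ⟨hyF, hyE⟩ := mem_sdiff.1 hy
  exact havoid _ hyF hyE y.1 (List.mem_toFinset.1 hP) (fst_mem_hedge y)

variable [H.LocallyFinite]

/-- **The open strand of a collision-free two-source configuration is unique**: any self-avoiding
path from `a` to `b ≠ a` with edges in a collision-free admissible `F` with sources `{a} ∆ {b}` is
THE strand (degree `1` at the source `a`, `≤ 2` everywhere). [folklore] -/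
theorem path_eq_of_mem_cfConfigs (hH : H ≤ zdGraph 2) {S : Finset (Site 2)} {a b : Site 2}
    {F : Finset (Sym2 (Site 2))} (hab : a ≠ b)
    (hF : F ∈ ((configs H S ({a} ∆ {b})).filter fun F => oscVerts S F = ∅)) {p q : H.Walk a b}
    (hp : p.IsPath) (hq : q.IsPath) (hpF : p.edges.toFinset ⊆ F) (hqF : q.edges.toFinset ⊆ F) :
    p = q := by
  obtain ⟨-, hAS, hdeg⟩ := (mem_cfConfigs_iff hH).1 hF
  have haA : a ∈ ({a} ∆ {b} : Finset (Site 2)) := by simp [mem_symmDiff, hab]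
  exact path_eq_of_edges_subset hp hq hpF hqF ((hdeg a (hAS haA)).1 haA).le
    (deg_le_two_of_mem_cfConfigs hH hF)

/-- A configuration on the vertices off a path is vertex-disjoint from the path. [folklore] -/
theorem vdisjoint_path_of_mem_cfConfigs_sdiff {Λ A : Finset (Site 2)} {a b : Site 2} (p : H.Walk a b)
    {F' : Finset (Sym2 (Site 2))}
    (hF' : F' ∈ ((configs H (Λ \ p.support.toFinset) A).filter
      fun F => oscVerts (Λ \ p.support.toFinset) F = ∅)) :
    ∀ z : Site 2, ∀ e₁ ∈ p.edges.toFinset, ∀ e₂ ∈ F', z ∈ e₁ → z ∉ e₂ := by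
  intro z e₁ he₁ e₂ he₂ hz₁ hz₂
  have hz := (mem_edgesIn_iff.1 (subset_of_mem_cfConfigs hF' he₂)).2 z hz₂
  exact (mem_sdiff.1 hz).2 (List.mem_toFinset.2 (mem_support_of_mem_edges_toFinset p e₁ he₁ z hz₁))

/-- **Gluing**: a self-avoiding path `γ` from `a` to `b ≠ a` inside `Λ` together with a source-free
collision-free configuration on the vertices of `Λ` off `γ` is a collision-free configuration on
`Λ` with sources `{a} ∆ {b}` (degrees add over the vertex-disjoint union). [folklore] -/
theorem union_path_mem_cfConfigs (hH : H ≤ zdGraph 2) {Λ : Finset (Site 2)} {a b : Site 2}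
    (hab : a ≠ b) {p : H.Walk a b} (hp : p ∈ pathsIn H Λ a b) {F' : Finset (Sym2 (Site 2))}
    (hF' : F' ∈ ((configs H (Λ \ p.support.toFinset) ∅).filter
      fun F => oscVerts (Λ \ p.support.toFinset) F = ∅)) :
    p.edges.toFinset ∪ F' ∈ ((configs H Λ ({a} ∆ {b})).filter fun F => oscVerts Λ F = ∅) := by
  obtain ⟨hpp, hpΛ⟩ := mem_pathsIn.1 hp
  have hpC : p.edges.toFinset ∈ ((configs H Λ ({a} ∆ {b})).filter fun F => oscVerts Λ F = ∅) :=
    mem_filter.2 ⟨edgesFinset_mem_configs hpp hab hpΛ, oscVerts_edges_eq_empty hH hpp Λ⟩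
  obtain ⟨hsub₁, hAS, hdeg₁⟩ := (mem_cfConfigs_iff hH).1 hpC
  obtain ⟨hsub₂, -, hdeg₂⟩ := (mem_cfConfigs_iff hH).1 hF'
  have hvdj := vdisjoint_path_of_mem_cfConfigs_sdiff p hF'
  refine (mem_cfConfigs_iff hH).2 ⟨union_subset hsub₁ fun e he => ?_, hAS, fun z hz => ?_⟩
  · have h := mem_edgesIn_iff.1 (hsub₂ he)
    exact mem_edgesIn_iff.2 ⟨h.1, fun z hz => (mem_sdiff.1 (h.2 z hz)).1⟩
  · rw [deg_union (vdj_disjoint hvdj)]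
    by_cases hzP : z ∈ p.support.toFinset
    · -- on the strand: no edge of `F'`, the strand's own degrees
      have h0 : #(F'.filter fun e => z ∈ e) = 0 := deg_eq_zero_iff.2 fun e he hze =>
        (mem_sdiff.1 ((mem_edgesIn_iff.1 (hsub₂ he)).2 z hze)).2 hzP
      rw [h0, add_zero]
      exact hdeg₁ z hz
    · -- off the strand: not a source, degree that of `F'`
      have h0 : #(p.edges.toFinset.filter fun e => z ∈ e) = 0 :=
        card_filter_mem_edges_eq_zero_of_notMem p fun h => hzP (List.mem_toFinset.2 h)
      have hzA : z ∉ ({a} ∆ {b} : Finset (Site 2)) := by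
        intro h
        rw [mem_symmDiff, mem_singleton, mem_singleton] at h
        rcases h with ⟨rfl, -⟩ | ⟨rfl, -⟩
        · exact hzP (List.mem_toFinset.2 p.start_mem_support)
        · exact hzP (List.mem_toFinset.2 p.end_mem_support)
      rw [h0, zero_add]
      exact ⟨fun h => absurd h hzA, fun _ => (hdeg₂ z (mem_sdiff.2 ⟨hz, hzP⟩)).2 (notMem_empty z)⟩

/-- **Peeling**: removing the open strand `γ` of a collision-free two-source configuration `F`
leaves a source-free collision-free configuration on the vertices OFF `γ` (the volume of
`sdiff_path_mem_cfConfigs` shrunk to `Λ ∖ γ`: no remaining edge touches `γ`). [folklore] -/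
theorem sdiff_path_mem_cfConfigs_sdiff (hH : H ≤ zdGraph 2) {Λ : Finset (Site 2)} {a b : Site 2}
    {F : Finset (Sym2 (Site 2))} (hF : F ∈ ((configs H Λ ({a} ∆ {b})).filter fun F => oscVerts Λ F = ∅))
    {p : H.Walk a b} (havoid : ∀ e ∈ F, e ∉ p.edges.toFinset → ∀ z ∈ p.support, z ∉ e) :
    F \ p.edges.toFinset ∈ ((configs H (Λ \ p.support.toFinset) ∅).filter
      fun F => oscVerts (Λ \ p.support.toFinset) F = ∅) := by
  obtain ⟨hsub, -, hdeg⟩ := (mem_cfConfigs_iff hH).1 (sdiff_path_mem_cfConfigs hH hF havoid)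
  refine (mem_cfConfigs_iff hH).2 ⟨fun e he => ?_, empty_subset _, fun z hz =>
    ⟨fun h => absurd h (notMem_empty z), fun _ => (hdeg z (mem_sdiff.1 hz).1).2 (notMem_empty z)⟩⟩
  have h := mem_edgesIn_iff.1 (hsub he)
  obtain ⟨heF, heP⟩ := mem_sdiff.1 he
  exact mem_edgesIn_iff.2 ⟨h.1, fun z hz => mem_sdiff.2 ⟨h.2 z hz, fun hzP =>
    havoid e heF heP z (List.mem_toFinset.1 hzP) hz⟩⟩

/-- **Walk/loop factorisation of the collision-free two-source configurations** (the combinatorial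
core):
`Σ_{F ∈ cfC(Λ; a,b)} x^{|F|} n^{loops F} = Σ_γ Σ_{F' ∈ cfC(Λ∖γ; ∅)} x^{|γ|} (x^{|F'|} n^{loops F'})`
by the bijection `F ↦ (γ(F), F ∖ γ(F))`, `(γ, F') ↦ γ ∪ F'`. [cite: MadrasSlade1993, §1.2] -/
theorem sum_cfConfigs_sources_eq_sum_sigma (hH : H ≤ zdGraph 2) (n x : ℝ) (Λ : Finset (Site 2))
    {a b : Site 2} (hab : a ≠ b) :
    ∑ F ∈ ((configs H Λ ({a} ∆ {b})).filter fun F => oscVerts Λ F = ∅), x ^ #F * n ^ loops Λ F ∅ =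
      ∑ q ∈ (pathsIn H Λ a b).sigma fun p => ((configs H (Λ \ p.support.toFinset) ∅).filter
          fun F => oscVerts (Λ \ p.support.toFinset) F = ∅),
        x ^ q.1.length * (x ^ #q.2 * n ^ loops (Λ \ q.1.support.toFinset) q.2 ∅) := by
  classical
  -- the open strand of each configuration
  have key : ∀ F ∈ ((configs H Λ ({a} ∆ {b})).filter fun F => oscVerts Λ F = ∅), ∃ p : H.Walk a b,
      p.IsPath ∧ (∀ z ∈ p.support, z ∈ Λ) ∧ p.edges.toFinset ⊆ F ∧
        ∀ e ∈ F, e ∉ p.edges.toFinset → ∀ z ∈ p.support, z ∉ e :=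
    fun F hF => exists_path_of_mem_cfConfigs hH _ F a rfl hab hF
  choose path hpath hS hE havoid using key
  refine sum_bij' (fun F hF => ⟨path F hF, F \ (path F hF).edges.toFinset⟩)
    (fun q _ => q.1.edges.toFinset ∪ q.2) (fun F hF => ?_) (fun q hq => ?_) (fun F hF => ?_)
    (fun q hq => ?_) (fun F hF => ?_)
  · -- `(γ(F), F ∖ γ(F))` is an admissible pair
    exact mem_sigma.2 ⟨mem_pathsIn.2 ⟨hpath F hF, hS F hF⟩,
      sdiff_path_mem_cfConfigs_sdiff hH hF (havoid F hF)⟩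
  · -- `γ ∪ F'` is a collision-free two-source configuration
    obtain ⟨hq₁, hq₂⟩ := mem_sigma.1 hq
    exact union_path_mem_cfConfigs hH hab hq₁ hq₂
  · -- `γ(F) ∪ (F ∖ γ(F)) = F`
    exact union_sdiff_of_subset (hE F hF)
  · -- `γ(γ ∪ F') = γ` (uniqueness of the strand) and `(γ ∪ F') ∖ γ = F'` (disjointness)
    obtain ⟨p, F'⟩ := q
    obtain ⟨hq₁, hq₂⟩ := mem_sigma.1 hq
    have hC := union_path_mem_cfConfigs hH hab hq₁ hq₂
    have hpq : ∀ h, path (p.edges.toFinset ∪ F') h = p := fun h =>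
      path_eq_of_mem_cfConfigs hH hab hC (hpath _ h) (mem_pathsIn.1 hq₁).1 (hE _ h) subset_union_left
    simp only
    rw [hpq, union_sdiff_cancel_left (vdj_disjoint (vdisjoint_path_of_mem_cfConfigs_sdiff p hq₂))]
  · -- the weights multiply
    have haΛ : a ∈ Λ := hS F hF a (path F hF).start_mem_support
    simp only
    rw [card_eq_length_add_card_sdiff (hpath F hF) (hE F hF),
      loops_eq_loops_sdiff_path_sdiff hH (hpath F hF) haΛ (hE F hF) (havoid F hF), pow_add,
      mul_assoc]

/-- **Registered helper · walk/loop factorisation of the strictly dilute two-source partition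
function**: on `H ≤ ℤ²`, for every loop fugacity `n`, edge fugacity `x`, volume `Λ` and sources
`a ≠ b`, `Z_{n,0,x}(Λ; {a} ∆ {b}) = Σ_{γ ∈ pathsIn H Λ a b} x^{|γ|} · Z_{n,0,x}(Λ ∖ γ; ∅)` — a
collision-free configuration with two sources is its open strand `γ` plus a gas of closed strands on the
vertices off `γ`; at `w = 0` configurations with collisions weigh `0`. The `n = 0` case is the tree's
`partitionFunction_zero_zero_eq_sum_paths`. [cite: MadrasSlade1993, §1.2] -/
theorem partitionFunction_sources_eq_sum_paths :
    ∀ (H : SimpleGraph (Site 2)) [H.LocallyFinite], H ≤ zdGraph 2 →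
      ∀ (n x : ℝ) (Λ : Finset (Site 2)) (a b : Site 2), a ≠ b →
        (⟨n, 0, x⟩ : DiluteLoopModel ℝ).partitionFunction H Λ ({a} ∆ {b}) =
          ∑ p ∈ DiluteLoopModel.pathsIn H Λ a b,
            x ^ p.length * (⟨n, 0, x⟩ : DiluteLoopModel ℝ).partitionFunction H (Λ \ p.support.toFinset) ∅ := by
  intro H _ hH n x Λ a b hab
  classical
  calc (⟨n, 0, x⟩ : DiluteLoopModel ℝ).partitionFunction H Λ ({a} ∆ {b})
      = ∑ F ∈ ((configs H Λ ({a} ∆ {b})).filter fun F => oscVerts Λ F = ∅), x ^ #F * n ^ loops Λ F ∅ :=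
        partitionFunction_dilute_eq_sum n x Λ _
    _ = ∑ q ∈ (pathsIn H Λ a b).sigma fun p => ((configs H (Λ \ p.support.toFinset) ∅).filter
            fun F => oscVerts (Λ \ p.support.toFinset) F = ∅),
          x ^ q.1.length * (x ^ #q.2 * n ^ loops (Λ \ q.1.support.toFinset) q.2 ∅) :=
        sum_cfConfigs_sources_eq_sum_sigma hH n x Λ hab
    _ = ∑ p ∈ pathsIn H Λ a b, ∑ F' ∈ ((configs H (Λ \ p.support.toFinset) ∅).filter
            fun F => oscVerts (Λ \ p.support.toFinset) F = ∅),
          x ^ p.length * (x ^ #F' * n ^ loops (Λ \ p.support.toFinset) F' ∅) :=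
        sum_sigma _ _ _
    _ = ∑ p ∈ DiluteLoopModel.pathsIn H Λ a b,
          x ^ p.length *
            (⟨n, 0, x⟩ : DiluteLoopModel ℝ).partitionFunction H (Λ \ p.support.toFinset) ∅ := by
        refine sum_congr rfl fun p _ => ?_
        rw [partitionFunction_dilute_eq_sum, mul_sum]

end Factorisation

end Summit.CriticalPhenomena.SAWScalingLimit.Theorems.AvoidanceLimit.Corner

end
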